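import Summits.HodgeConjecture.HodgeConjecture.Cruxes.BlochSeedDiscOne.SigmaH
import Summits.HodgeConjecture.HodgeConjecture.Cruxes.BlochSeedDiscOne.MinMassWindowH14
import Summits.HodgeConjecture.HodgeConjecture.Cruxes.BlochSeedDiscOne.AxisPhaseTorus

/-!
line stmt-HodgeConjecture-18881 Cruxes/BlochSeedDiscOne/Lines/birth.lean 814a6a70c14e831a stub_rung_pad4_seedAt

# AxisRuleDInhabitant — RULE D IS FREE TOO: an explicit (A1)-clean AXIS design `R⋆` with `Disj`, `RuleD` (both clauses), `HallUp`,
# `HallPlusUp 8` and `μ = 32 ≠ 0` at every height `h ≥ 3`; the BUDGET-FREE door of record `SPlusB h ⊤` is FALSE, and in the axis room the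
# statement of record `SPlus h sigmaH 0` is carried by the Σ-BUDGET ALONE
(plan-lens-HodgeAV-strengthen g21, 2026-08-31; STRENGTHEN-MEMO-31 §5; sequel to `AxisRoomInhabitant24` (same day), which showed that every
binder except `RuleD` is met by the 56-copy design `D⋆(24)` WITH the budget.)

HONESTY LABEL.  Letter-model statements about `DepthBoundA4.Design` only (Chern-character words on a letter model ≠ sheaves ≠ monads ≠ a SEED).
NOTHING here is proved toward HC ∕ HC_CM ∕ HC_AV ∕ №4 ∕ 26512 ∕ 18881 ∕ H2; no rung, no shell of `SPlus 14 sigmaH 0` is closed — `R⋆` VIOLATES the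
Σ-budget of record (9908 copies; the budget allows ≤ 116), so it inhabits nothing of record and refutes nothing of record.  It is kernel-checked
EVIDENCE for the strengthen lens: it retires the budget-free strengthening `SPlusB h ⊤` (and `SPlusB h AxisRoom`) at every height `h ≥ 3`, i.e.
every candidate S⁺ on this road whose proof would not USE the size bound.

THE CONSTRUCTION (the BOX CALCULUS of memo-31 §4).  An axis letter of phase `p ∈ ℤ/4` and co-level `n` at height 3 is `axL p n = (3 − n; n·i^p)`;
a BOX is a phase vector `τ ∈ (ℤ/4)⁴`, and the pattern position `c ∈ ℕ⁴` of box `τ` is the cell `inst τ c = (axL (τ f) (c f))_f` (position `0` on a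
factor is the hub letter, shared by all boxes).  COVARIANCE (§2): `coef_s(axL p n) = χ_s(p)·coef_s(axL 0 n)` with `χ_e = conj(i^p)`, `χ_ē = i^p`,
`χ = 1` on e-free symbols, hence `cellCoef (inst τ c) w = χ_w(τ)·bcc c w` and the class tensor of a boxed design factors through the box character
sums `X(w) = Σ_τ χ_w(τ)`, `Y(w) = Σ_τ m₁(τ) χ_w(τ)` and two PATTERN sums (`T_boxed`, proved structurally; no table over the 2 251 entries).
`R⋆` = `3608·hub⁴` + the 30 boxes of the corank-14 torus witness `ω₁₄` (`PhaseTorusLawN14.omega14Z`, phase vectors `PH`), each filled with the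
S₄-symmetric PARITY PATTERN of types `1111, 2111, 1000, 2110, 2200, 3100, 2210, 3110, 3200` and weights `24, 3, 15, 3, 3, 1, 1, 1, 2` — even
co-level sum on the N-side (`ZN` and `𝟙 = 1111`), odd on the P-side (`ZP`) — with the `𝟙`-cell of box `τ` weighted `24 + ω₁₄(τ) ∈ {23, 25, 26}`.
The pattern is ZERO-SUM (all fifteen multilinear moments of `(−1)^{|c|}·weight` vanish), so every box contributes to the mixed rows only through
its `ω`-perturbation: `T(R⋆)(w) = 0` on mixed words `≠ eeee, ēēēē`, `= 2708·3^deg` on e-free words, `μ = 32`.  RULE D holds because the pattern is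
closed under the two supplier moves INSIDE each box (deeper on the block, equal off it: `supplies_of_supPatB`, `nullStep_axL`), certified at
PATTERN level (`certN`, `certP`, 75 positions) and transported along the rays; `Disj` is co-level-sum PARITY; Hall ∕ PortHall₈ is the heavy hub
(`3608 = 3600 + 8` above every P-cell).  Ring 3 is minimal for this calculus (inside co-level ≤ 2 no parity pattern closes: memo-31 §4.4),
consistent with `RingTwoMassLaw`.

KERNEL CERTIFICATE.  §5: ONE 625-row `decide +kernel` table on the box formula (pattern-level arithmetic), `μ`, rank `2708`, copies `9908`, P-mass
`3600`; §7: pattern tables (bounds, parities, positivity, the two closure certificates) by `decide`; everything else is structural.  §10 transports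
`R⋆` to every height `h ≥ 3` (`HeightTower.shiftD`, `onAlphabet_shift_up`, the shift-invariance lemmas of `RuleDPlate`).

WHAT IT SETTLES (S⁺-ledger v1.44 rows #222–#228; with `AxisRoomInhabitant24`):
* `not_sPlusB_top : 3 ≤ h → ¬ SPlusB h (fun _ => True)` — the budget-free door of record is FALSE at every height ≥ 3, now IN THE KERNEL and
  IN THE AXIS ROOM (`not_sPlusB_axisRoom : ¬ SPlusB h AxisRoom`).  NOT NEW AS A CLAIM: the bus already records a budget-free inhabitant of every
  v4.1 clause on RING 2 over weak arrows (anomaly g14's 13 106-copy `RuleD ∧ Disj ∧ (A1) ∧ μ ≠ 0` design + s4-search-1 g35's `854·hub⁴` Hall repair,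
  see the `RingTwoEffEmpty` header; the `RuleDPlate` docstring still lists Hall there as undecided) — that inhabitant is pen ∕ compute level and uses
  DIAGONAL floor letters; `R⋆` is axis-only, smaller (9 908 copies), uniform in `h`, and comes with its mechanism (box covariance + parity pattern),
  which produces a whole family.  `sPlusB_excludes_Rstar`: a budget predicate under which the door holds must exclude `R⋆(h)`.
* Hence on the AXIS road the statement of record is a pure SIZE statement: its one binder not met by a RULE-D, `Disj`, (A1)-clean, Hall axis
  design with `μ ≠ 0` is `Σ-H(D) + 28(rank − 4) ≤ 3136` (`copies + rank ≤ 116`); with the RULE-D-free law true at rank ≤ 21 (`AxisPhaseTorus21`)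
  and `D⋆(24)` of `AxisRoomInhabitant24` (56 copies, budget met, `¬RuleD`), the live S⁺ of this road is «no RULE-D (A1)-clean Hall axis design with
  `μ ≠ 0` has `copies + rank ≤ 116`» — a FINITE census (memo-31 §6 states it with the lower bounds rank ≥ 22, P-mass ≥ 14, copies ≥ 50).
PROVENANCE (irrelevant to validity): g21 `eng/boxpattern.py` (closure + Stiemke LP over S₄-symmetric type sets), `eng/intweights.py`,
`eng/ruled_design.py` (stdlib Python, exact integers: all checks of this file incl. RULE D verbatim over the 1 687 distinct cells), `eng/emit_ruled.py`
→ §4.  `decide +kernel` ∕ `decide` only: no `native_decide`, no `sorry`, no `axiom`, no `instance`, no notation, no Literature fact, no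
`allowUnsafeReducibility`.
-/

set_option linter.dupNamespace false
set_option autoImplicit false
set_option maxRecDepth 16384
set_option maxHeartbeats 8000000

namespace Summit.HodgeConjecture.HodgeConjecture.Cruxes.BlochSeedDiscOne.AxisRuleDInhabitant

open Summit.HodgeConjecture.HodgeConjecture.Cruxes.BlochSeedDiscOne.DepthBoundA4
open Summit.HodgeConjecture.HodgeConjecture.Cruxes.BlochSeedDiscOne.HeightTower
open Summit.HodgeConjecture.HodgeConjecture.Cruxes.BlochSeedDiscOne.LeggedFloor (NullStep Supplies Detects RuleDP RuleD Disj)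
open Summit.HodgeConjecture.HodgeConjecture.Cruxes.BlochSeedDiscOne.HallB136 (HallUp notDeadB weakLiveB weakLiveB_of)
open Summit.HodgeConjecture.HodgeConjecture.Cruxes.BlochSeedDiscOne.RuleDPlate
  (HallPlusUp hallUp_of_hallPlusUp hallUp_shiftD hallPlusUp_shiftD disj_shiftD ruleD_shiftD BudgetClause budgetClause_shiftD SPlusB SPlus Room)
open Summit.HodgeConjecture.HodgeConjecture.Cruxes.BlochSeedDiscOne.SigmaH (sigmaH sigmaH_shiftD copies_le_of_budget)
open Summit.HodgeConjecture.HodgeConjecture.Cruxes.BlochSeedDiscOne.MinMassWindowH14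
  (gmul toG toG_gmul symv toG_symv chRaw toG_chRaw listSum listSum_nil listSum_cons listSum_append T_eq_listSum padd psub pscale
   toG_padd toG_psub toG_pscale allB allB_iff anyB anyB_iff cellOf wordOf allWords mem_allWords efreeB efree_of_efreeB efreeB_of_efree
   blochB bloch_of_blochB degB deg_eq_degB mem_suppN_of mem_suppP_of exists_of_mem_suppN exists_of_mem_suppP forceInt forceInt_eq)
open Summit.HodgeConjecture.HodgeConjecture.Cruxes.BlochSeedDiscOne.AxisPhaseTorus (AxisCell AxisRoom)

/-! ## §1 Phases, axis letters at height 3, boxes -/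

/-- real part of `i^p`. -/
def re4 (p : Fin 4) : ℤ := match p with | ⟨0, _⟩ => 1 | ⟨1, _⟩ => 0 | ⟨2, _⟩ => -1 | ⟨_, _⟩ => 0
/-- imaginary part of `i^p`. -/
def im4 (p : Fin 4) : ℤ := match p with | ⟨0, _⟩ => 0 | ⟨1, _⟩ => 1 | ⟨2, _⟩ => 0 | ⟨_, _⟩ => -1

/-- the AXIS letter of phase `p` and co-level `n` at height 3: `(3 − n; n·i^p)` (`n = 0` is the hub `(3;0,0)` for every `p`). -/
def axL (p : Fin 4) (n : ℕ) : Letter := ⟨3 - n, n * re4 p, n * im4 p⟩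

/-- co-level vectors (pattern cells) and phase vectors (boxes). -/
abbrev PV := Fin 4 → ℕ
/-- phase vectors. -/
abbrev Ph := Fin 4 → Fin 4

/-- a co-level vector from four naturals. -/
def pvOf (a b c d : ℕ) : PV := fun f =>
  match f with
  | ⟨0, _⟩ => a
  | ⟨1, _⟩ => b
  | ⟨2, _⟩ => c
  | ⟨_, _⟩ => d

/-- a phase vector from four phases. -/
def phOf (a b c d : Fin 4) : Ph := fun f =>
  match f with
  | ⟨0, _⟩ => a
  | ⟨1, _⟩ => b
  | ⟨2, _⟩ => c
  | ⟨_, _⟩ => d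

/-- the cell of box `τ` at pattern position `c`: factor `f` carries the axis letter of phase `τ f` and co-level `c f`. -/
def inst (τ : Ph) (c : PV) : Cell := fun f => axL (τ f) (c f)

/-- an instantiated pattern entry. -/
def instE (τ : Ph) (e : PV × ℕ) : Cell × ℕ := (inst τ e.1, e.2)

/-! ## §2 Phase covariance of the class coefficients: `coef_s(axL p n) = χ_s(p) · coef_s(axL 0 n)` -/

/-- raw letter character `χ_s(p)`: `e ↦ conj(i^p)`, `ē ↦ i^p`, `1, h, pt ↦ 1`. -/
def lchR (p : Fin 4) (s : Sym) : ℤ × ℤ :=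
  match s with
  | .e => (re4 p, -im4 p)
  | .ebar => (re4 p, im4 p)
  | _ => (1, 0)

/-- the phase-0 axis letter of co-level `n`: `(3 − n; n)`. -/
def bL (n : ℕ) : Letter := ⟨3 - n, n, 0⟩

/-- raw base coefficient of symbol `s` at co-level `n` (phase 0). -/
def bsymv (s : Sym) (n : ℕ) : ℤ × ℤ := symv (bL n) s

theorem symv_axL (p : Fin 4) (n : ℕ) (s : Sym) : symv (axL p n) s = gmul (lchR p s) (bsymv s n) := by
  fin_cases p <;> cases s <;> (simp only [symv, axL, lchR, bsymv, bL, re4, im4, gmul, Prod.mk.injEq]; constructor <;> ring)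

theorem coef_axL (p : Fin 4) (n : ℕ) (s : Sym) : s.coef (axL p n) = toG (lchR p s) * toG (bsymv s n) := by
  rw [← toG_symv, symv_axL, toG_gmul]

/-- the word character of box `τ`: `χ_w(τ) = ∏_f χ_{w f}(τ f)`. -/
def wch (τ : Ph) (w : Word) : GaussianInt := ∏ f : Fin 4, toG (lchR (τ f) (w f))

/-- the base (phase-0) coefficient of pattern position `c` at word `w`. -/
def bcc (c : PV) (w : Word) : GaussianInt := ∏ f : Fin 4, toG (bsymv (w f) (c f))

/-- **COVARIANCE**: `cellCoef (inst τ c) w = χ_w(τ) · bcc c w`. -/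
theorem cellCoef_inst (τ : Ph) (c : PV) (w : Word) : cellCoef (inst τ c) w = wch τ w * bcc c w := by
  simp only [cellCoef, inst, coef_axL, wch, bcc, ← Finset.prod_mul_distrib]

/-- raw evaluators. -/
def wchR (τ : Ph) (w : Word) : ℤ × ℤ :=
  gmul (gmul (gmul (lchR (τ 0) (w 0)) (lchR (τ 1) (w 1))) (lchR (τ 2) (w 2))) (lchR (τ 3) (w 3))
/-- raw base coefficient. -/
def bccR (c : PV) (w : Word) : ℤ × ℤ :=
  gmul (gmul (gmul (bsymv (w 0) (c 0)) (bsymv (w 1) (c 1))) (bsymv (w 2) (c 2))) (bsymv (w 3) (c 3))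

theorem toG_wchR (τ : Ph) (w : Word) : toG (wchR τ w) = wch τ w := by
  simp only [wchR, toG_gmul, wch, Fin.prod_univ_four]

theorem toG_bccR (c : PV) (w : Word) : toG (bccR c w) = bcc c w := by
  simp only [bccR, toG_gmul, bcc, Fin.prod_univ_four]

/-! ## §3 Box sums -/

/-- pattern sum `Σ_{(c,m) ∈ Z} m · bcc c w`. -/
def patS (w : Word) (Z : List (PV × ℕ)) : GaussianInt := (Z.map fun e => (e.2 : GaussianInt) * bcc e.1 w).sum

theorem patS_nil (w : Word) : patS w [] = 0 := by simp [patS]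

theorem patS_cons (w : Word) (e : PV × ℕ) (Z : List (PV × ℕ)) : patS w (e :: Z) = (e.2 : GaussianInt) * bcc e.1 w + patS w Z := by
  simp [patS]

theorem listSum_map_instE (w : Word) (τ : Ph) (Z : List (PV × ℕ)) : listSum w (Z.map (instE τ)) = wch τ w * patS w Z := by
  induction Z with
  | nil => simp [listSum, patS]
  | cons e Z ih =>
    rw [List.map_cons, listSum_cons, ih]
    simp only [instE, cellCoef_inst, patS, List.map_cons, List.sum_cons]
    ring

theorem listSum_flatten (w : Word) (L : List (List (Cell × ℕ))) : listSum w L.flatten = (L.map (listSum w)).sum := by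
  induction L with
  | nil => simp [listSum]
  | cons l L ih => rw [List.flatten_cons, listSum_append, ih, List.map_cons, List.sum_cons]

/-- raw pattern sum (accumulator form). -/
def patSR (w : Word) : List (PV × ℕ) → ℤ → ℤ → ℤ × ℤ
  | [], p, q => (p, q)
  | (c, m) :: Z, p, q =>
    forceInt (p + (m : ℤ) * (bccR c w).1) fun p' => forceInt (q + (m : ℤ) * (bccR c w).2) fun q' => patSR w Z p' q'

theorem toG_patSR (w : Word) (Z : List (PV × ℕ)) (p q : ℤ) : toG (patSR w Z p q) = toG (p, q) + patS w Z := by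
  induction Z generalizing p q with
  | nil => simp [patSR, patS]
  | cons e Z ih =>
    obtain ⟨c, m⟩ := e
    have hc : toG (bccR c w) = bcc c w := toG_bccR c w
    simp only [patSR, forceInt_eq]
    rw [ih, patS_cons, ← hc]
    ext <;> simp [toG] <;> ring

/-- the N-box of phase vector `τ` with `𝟙`-weight `m₁`: the `𝟙`-cell `inst τ 𝟙` with multiplicity `m₁`, then the pattern `ZN` instantiated. -/
def boxN (ONEV : PV) (ZN : List (PV × ℕ)) (e : Ph × ℕ) : List (Cell × ℕ) := (inst e.1 ONEV, e.2) :: ZN.map (instE e.1)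
/-- the P-box of phase vector `τ`: the pattern `ZP` instantiated. -/
def boxP (ZP : List (PV × ℕ)) (e : Ph × ℕ) : List (Cell × ℕ) := ZP.map (instE e.1)

/-- box character sums `X(w) = Σ_τ χ_w(τ)` and `Y(w) = Σ_τ m₁(τ) χ_w(τ)`. -/
def Xs (PH : List (Ph × ℕ)) (w : Word) : GaussianInt := (PH.map fun e => wch e.1 w).sum
/-- weighted. -/
def Ys (PH : List (Ph × ℕ)) (w : Word) : GaussianInt := (PH.map fun e => (e.2 : GaussianInt) * wch e.1 w).sum

theorem Xs_nil (w : Word) : Xs [] w = 0 := by simp [Xs]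
theorem Ys_nil (w : Word) : Ys [] w = 0 := by simp [Ys]
theorem Xs_cons (w : Word) (e : Ph × ℕ) (PH : List (Ph × ℕ)) : Xs (e :: PH) w = wch e.1 w + Xs PH w := by simp [Xs]
theorem Ys_cons (w : Word) (e : Ph × ℕ) (PH : List (Ph × ℕ)) : Ys (e :: PH) w = (e.2 : GaussianInt) * wch e.1 w + Ys PH w := by
  simp [Ys]

theorem listSum_boxesN (w : Word) (ONEV : PV) (ZN : List (PV × ℕ)) (PH : List (Ph × ℕ)) :
    listSum w (PH.map (boxN ONEV ZN)).flatten = Ys PH w * bcc ONEV w + Xs PH w * patS w ZN := by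
  rw [listSum_flatten, List.map_map]
  induction PH with
  | nil => simp [Xs, Ys]
  | cons e PH ih =>
    rw [List.map_cons, List.sum_cons, ih, Xs_cons, Ys_cons]
    simp only [Function.comp, boxN, listSum_cons, listSum_map_instE, cellCoef_inst]
    ring

theorem listSum_boxesP (w : Word) (ZP : List (PV × ℕ)) (PH : List (Ph × ℕ)) :
    listSum w (PH.map (boxP ZP)).flatten = Xs PH w * patS w ZP := by
  rw [listSum_flatten, List.map_map]
  induction PH with
  | nil => simp [Xs]
  | cons e PH ih =>
    rw [List.map_cons, List.sum_cons, ih, Xs_cons]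
    simp only [Function.comp, boxP, listSum_map_instE]
    ring

/-- raw `X`, `Y` (accumulator form). -/
def XsR (w : Word) : List (Ph × ℕ) → ℤ → ℤ → ℤ × ℤ
  | [], p, q => (p, q)
  | (τ, _) :: PH, p, q => forceInt (p + (wchR τ w).1) fun p' => forceInt (q + (wchR τ w).2) fun q' => XsR w PH p' q'
/-- raw `Y`. -/
def YsR (w : Word) : List (Ph × ℕ) → ℤ → ℤ → ℤ × ℤ
  | [], p, q => (p, q)
  | (τ, m) :: PH, p, q =>
    forceInt (p + (m : ℤ) * (wchR τ w).1) fun p' => forceInt (q + (m : ℤ) * (wchR τ w).2) fun q' => YsR w PH p' q'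

theorem toG_XsR (w : Word) (PH : List (Ph × ℕ)) (p q : ℤ) : toG (XsR w PH p q) = toG (p, q) + Xs PH w := by
  induction PH generalizing p q with
  | nil => simp [XsR, Xs]
  | cons e PH ih =>
    obtain ⟨τ, m⟩ := e
    have hc : toG (wchR τ w) = wch τ w := toG_wchR τ w
    simp only [XsR, forceInt_eq]
    rw [ih, Xs_cons, ← hc]
    ext <;> simp [toG] <;> ring

theorem toG_YsR (w : Word) (PH : List (Ph × ℕ)) (p q : ℤ) : toG (YsR w PH p q) = toG (p, q) + Ys PH w := by
  induction PH generalizing p q with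
  | nil => simp [YsR, Ys]
  | cons e PH ih =>
    obtain ⟨τ, m⟩ := e
    have hc : toG (wchR τ w) = wch τ w := toG_wchR τ w
    simp only [YsR, forceInt_eq]
    rw [ih, Ys_cons, ← hc]
    ext <;> simp [toG] <;> ring

/-- **the boxed design**: N = a hub entry, then the N-boxes; P = the P-boxes. -/
def boxed (hubE : Cell × ℕ) (ONEV : PV) (ZN ZP : List (PV × ℕ)) (PH : List (Ph × ℕ)) : Design :=
  ⟨hubE :: (PH.map (boxN ONEV ZN)).flatten, (PH.map (boxP ZP)).flatten⟩

/-- raw class tensor of the boxed design: `m_hub·ch(hub) + Y·bcc(𝟙) + X·(patS ZN − patS ZP)`. -/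
def FR (hubE : Cell × ℕ) (ONEV : PV) (ZN ZP : List (PV × ℕ)) (PH : List (Ph × ℕ)) (w : Word) : ℤ × ℤ :=
  padd (pscale hubE.2 (chRaw hubE.1 w))
    (padd (gmul (YsR w PH 0 0) (bccR ONEV w)) (gmul (XsR w PH 0 0) (psub (patSR w ZN 0 0) (patSR w ZP 0 0))))

theorem toG_zero'' : toG ((0 : ℤ), (0 : ℤ)) = 0 := by ext <;> simp [toG]

/-- **THE BOX FORMULA** for the class tensor of a boxed design. -/
theorem T_boxed (hubE : Cell × ℕ) (ONEV : PV) (ZN ZP : List (PV × ℕ)) (PH : List (Ph × ℕ)) (w : Word) :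
    (boxed hubE ONEV ZN ZP PH).T w = toG (FR hubE ONEV ZN ZP PH w) := by
  rw [T_eq_listSum, boxed, listSum_cons, listSum_boxesN, listSum_boxesP, FR, toG_padd, toG_padd, toG_pscale, toG_chRaw, toG_gmul,
    toG_gmul, toG_YsR, toG_XsR, toG_bccR, toG_psub, toG_patSR, toG_patSR, toG_zero'', zero_add, zero_add, zero_add, zero_add]
  push_cast
  ring


/-! ## §4 The data: the 30 boxes of `ω₁₄`, the parity pattern, the design `R⋆` (height 3) -/

/-- the 30 boxes: phase vectors of `ω₁₄` (positive support first) with the multiplicity `24 + ω(τ)` of their `𝟙`-cell. -/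
def PH : List (Ph × ℕ) := [
  (phOf 0 0 1 3, 25),
  (phOf 0 1 3 0, 25),
  (phOf 0 3 0 1, 26),
  (phOf 1 0 1 2, 25),
  (phOf 1 1 0 2, 25),
  (phOf 1 2 1 0, 25),
  (phOf 1 3 2 2, 25),
  (phOf 2 0 1 1, 25),
  (phOf 2 1 2 3, 26),
  (phOf 2 3 3 0, 25),
  (phOf 3 0 3 2, 25),
  (phOf 3 2 0 3, 25),
  (phOf 3 2 2 1, 25),
  (phOf 3 2 3 0, 25),
  (phOf 0 0 0 2, 23),
  (phOf 0 2 0 0, 23),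
  (phOf 0 2 3 1, 23),
  (phOf 0 3 1 2, 23),
  (phOf 1 0 0 1, 23),
  (phOf 1 0 2 3, 23),
  (phOf 1 1 1 3, 23),
  (phOf 1 3 1 1, 23),
  (phOf 2 0 2 2, 23),
  (phOf 2 1 1 2, 23),
  (phOf 2 2 2 0, 23),
  (phOf 2 2 3 3, 23),
  (phOf 3 1 2 0, 23),
  (phOf 3 1 3 3, 23),
  (phOf 3 3 0 0, 23),
  (phOf 3 3 3 1, 23)]

/-- N-pattern (even co-level sum, the `𝟙`-cell apart): 30 cells. -/
def ZN : List (PV × ℕ) := [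
  (pvOf 0 1 1 2, 3),
  (pvOf 0 1 2 1, 3),
  (pvOf 0 2 1 1, 3),
  (pvOf 1 0 1 2, 3),
  (pvOf 1 0 2 1, 3),
  (pvOf 1 1 0 2, 3),
  (pvOf 1 1 2 0, 3),
  (pvOf 1 2 0 1, 3),
  (pvOf 1 2 1 0, 3),
  (pvOf 2 0 1 1, 3),
  (pvOf 2 1 0 1, 3),
  (pvOf 2 1 1 0, 3),
  (pvOf 0 0 2 2, 3),
  (pvOf 0 2 0 2, 3),
  (pvOf 0 2 2 0, 3),
  (pvOf 2 0 0 2, 3),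
  (pvOf 2 0 2 0, 3),
  (pvOf 2 2 0 0, 3),
  (pvOf 0 0 1 3, 1),
  (pvOf 0 0 3 1, 1),
  (pvOf 0 1 0 3, 1),
  (pvOf 0 1 3 0, 1),
  (pvOf 0 3 0 1, 1),
  (pvOf 0 3 1 0, 1),
  (pvOf 1 0 0 3, 1),
  (pvOf 1 0 3 0, 1),
  (pvOf 1 3 0 0, 1),
  (pvOf 3 0 0 1, 1),
  (pvOf 3 0 1 0, 1),
  (pvOf 3 1 0 0, 1)]

/-- P-pattern (odd co-level sum): 44 cells. -/
def ZP : List (PV × ℕ) := [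
  (pvOf 1 1 1 2, 3),
  (pvOf 1 1 2 1, 3),
  (pvOf 1 2 1 1, 3),
  (pvOf 2 1 1 1, 3),
  (pvOf 0 0 0 1, 15),
  (pvOf 0 0 1 0, 15),
  (pvOf 0 1 0 0, 15),
  (pvOf 1 0 0 0, 15),
  (pvOf 0 1 2 2, 1),
  (pvOf 0 2 1 2, 1),
  (pvOf 0 2 2 1, 1),
  (pvOf 1 0 2 2, 1),
  (pvOf 1 2 0 2, 1),
  (pvOf 1 2 2 0, 1),
  (pvOf 2 0 1 2, 1),
  (pvOf 2 0 2 1, 1),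
  (pvOf 2 1 0 2, 1),
  (pvOf 2 1 2 0, 1),
  (pvOf 2 2 0 1, 1),
  (pvOf 2 2 1 0, 1),
  (pvOf 0 1 1 3, 1),
  (pvOf 0 1 3 1, 1),
  (pvOf 0 3 1 1, 1),
  (pvOf 1 0 1 3, 1),
  (pvOf 1 0 3 1, 1),
  (pvOf 1 1 0 3, 1),
  (pvOf 1 1 3 0, 1),
  (pvOf 1 3 0 1, 1),
  (pvOf 1 3 1 0, 1),
  (pvOf 3 0 1 1, 1),
  (pvOf 3 1 0 1, 1),
  (pvOf 3 1 1 0, 1),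
  (pvOf 0 0 2 3, 2),
  (pvOf 0 0 3 2, 2),
  (pvOf 0 2 0 3, 2),
  (pvOf 0 2 3 0, 2),
  (pvOf 0 3 0 2, 2),
  (pvOf 0 3 2 0, 2),
  (pvOf 2 0 0 3, 2),
  (pvOf 2 0 3 0, 2),
  (pvOf 2 3 0 0, 2),
  (pvOf 3 0 0 2, 2),
  (pvOf 3 0 2 0, 2),
  (pvOf 3 2 0 0, 2)]


/-- the fully charged co-level-1 position `𝟙 = (1,1,1,1)` (N-side; carries the `ω`-perturbation). -/
def ONEV : PV := pvOf 1 1 1 1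
/-- the hub position. -/
def ZEROV : PV := pvOf 0 0 0 0
/-- the hub letter and cell at height 3. -/
def hub3 : Letter := ⟨3, 0, 0⟩
/-- hub cell. -/
def hubC : Cell := cellOf hub3 hub3 hub3 hub3
/-- the heavy hub entry: multiplicity `3608 = (P-mass 3600) + 8`. -/
def hubE : Cell × ℕ := (hubC, 3608)

/-- **THE DESIGN `R⋆`** (height 3): N = `3608·hub⁴` and, in each of the 30 boxes, the `𝟙`-cell (multiplicity `24 + ω(τ)`) and the even
pattern `ZN`; P = the odd pattern `ZP` in each box.  931 N-entries (mass 6308), 1320 P-entries (mass 3600); rank 2708, 9908 copies. -/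
def Rstar : Design := boxed hubE ONEV ZN ZP PH

/-! ## §5 (A1), `μ`, rank, copies: ONE 625-row table on the box formula (pattern-level arithmetic only) -/

/-- raw class tensor of `R⋆` by the box formula. -/
def FRs (w : Word) : ℤ × ℤ := FR hubE ONEV ZN ZP PH w

theorem T_Rstar (w : Word) : Rstar.T w = toG (FRs w) := T_boxed hubE ONEV ZN ZP PH w

/-- row test: e-free rows `2708·3^deg`, mixed rows `0` except the two Bloch words. -/
def rowR (w : Word) : Bool :=
  bif efreeB w then decide (FRs w = (2708 * 3 ^ degB w, 0)) else (blochB w || decide (FRs w = (0, 0)))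

theorem tableR : allB allWords rowR = true := by decide +kernel

theorem mu_rawR : FRs Word.eeee = (32, 0) := by decide +kernel

theorem EEEE_rawR : FRs Word.EEEE = (32, 0) := by decide +kernel

theorem efree_rows_R (w : Word) (hw : w.efree) : Rstar.T w = ⟨2708 * 3 ^ w.deg, 0⟩ := by
  have hr := (allB_iff _ _).1 tableR w (mem_allWords w)
  unfold rowR at hr
  rw [efreeB_of_efree hw] at hr
  simp only [cond_true, decide_eq_true_eq] at hr
  rw [T_Rstar, hr, deg_eq_degB]
  rfl

/-- **`R⋆` is (A1)-clean.** -/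
theorem a1_R : Rstar.A1 := by
  constructor
  · intro w hne h1 h2
    have hr := (allB_iff _ _).1 tableR w (mem_allWords w)
    unfold rowR at hr
    cases hb : efreeB w with
    | true => exact (hne (efree_of_efreeB hb)).elim
    | false =>
      rw [hb] at hr
      simp only [cond_false, Bool.or_eq_true, decide_eq_true_eq] at hr
      rcases hr with hbl | hz
      · rcases bloch_of_blochB hbl with h | h
        · exact (h1 h).elim
        · exact (h2 h).elim
      · rw [T_Rstar, hz]; ext <;> simp [toG]
  · intro w w' hw hw' hd
    rw [efree_rows_R w hw, efree_rows_R w' hw', hd]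

/-- **`μ(R⋆) = 32`.** -/
theorem mu_R : Rstar.mu = ⟨32, 0⟩ := by
  show Rstar.T Word.eeee = _
  rw [T_Rstar, mu_rawR]
  rfl

theorem mu_ne_R : Rstar.mu ≠ 0 := by
  rw [mu_R]
  decide

theorem copies_R : Rstar.copies = 9908 := by decide +kernel

theorem rank_R : Rstar.rank = 2708 := by decide +kernel

theorem massP_R : (Rstar.P.map Prod.snd).sum = 3600 := by decide +kernel

/-! ## §6 Letters of `R⋆`: alphabet, axis, co-level, the weak arrow to the hub, NULL steps along a ray -/

theorem re4_sq_add_im4_sq (p : Fin 4) : re4 p * re4 p + im4 p * im4 p = 1 := by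
  fin_cases p <;> rfl

theorem re4_mul_im4 (p : Fin 4) : re4 p * im4 p = 0 := by
  fin_cases p <;> rfl

theorem abs_re4_add_abs_im4 (p : Fin 4) : |re4 p| + |im4 p| = 1 := by
  fin_cases p <;> rfl

theorem isAxis_axL (p : Fin 4) (n : ℕ) : (axL p n).isAxis := by
  show (n : ℤ) * re4 p * ((n : ℤ) * im4 p) = 0
  have h := re4_mul_im4 p
  calc (n : ℤ) * re4 p * ((n : ℤ) * im4 p) = (n : ℤ) * (n : ℤ) * (re4 p * im4 p) := by ring
    _ = 0 := by rw [h, mul_zero]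

theorem colevel_axL (p : Fin 4) (n : ℕ) : (axL p n).colevel = n := by
  show |(n : ℤ) * re4 p| + |(n : ℤ) * im4 p| = n
  rw [abs_mul, abs_mul, Nat.abs_cast, ← mul_add, abs_re4_add_abs_im4, mul_one]

theorem onAlphabet_axL (p : Fin 4) {n : ℕ} (hn : n ≤ 3) : (axL p n).OnAlphabet 3 := by
  have hc := colevel_axL p n
  simp only [Letter.colevel] at hc
  refine ⟨?_, ?_⟩
  · show (3 - (n : ℤ)) + |(n : ℤ) * re4 p| + |(n : ℤ) * im4 p| = 3
    have : (3 - (n : ℤ)) + |(n : ℤ) * re4 p| + |(n : ℤ) * im4 p| = (3 - (n : ℤ)) + (|(n : ℤ) * re4 p| + |(n : ℤ) * im4 p|) := by ring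
    rw [this]
    show (3 - (n : ℤ)) + (|(axL p n).x| + |(axL p n).y|) = 3
    rw [hc]; ring
  · show (0 : ℤ) ≤ 3 - (n : ℤ)
    omega

/-- the hub letter is weakly above every axis letter of height 3. -/
theorem notDead_axL_hub (p : Fin 4) (n : ℕ) : NotDead (axL p n) hub3 := by
  rcases Nat.eq_zero_or_pos n with rfl | hn
  · left
    simp [axL, hub3]
  · right
    refine ⟨?_, ?_⟩
    · show 3 - (n : ℤ) < 3
      omega
    · show (0 - (n : ℤ) * re4 p) ^ 2 + (0 - (n : ℤ) * im4 p) ^ 2 ≤ (3 - (3 - (n : ℤ))) ^ 2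
      have h := re4_sq_add_im4_sq p
      have e : (0 - (n : ℤ) * re4 p) ^ 2 + (0 - (n : ℤ) * im4 p) ^ 2 = (n : ℤ) ^ 2 * (re4 p * re4 p + im4 p * im4 p) := by ring
      rw [e, h]
      nlinarith

/-- a strictly deeper letter on the SAME ray is a NULL step below. -/
theorem nullStep_axL (p : Fin 4) {m n : ℕ} (h : n < m) : NullStep (axL p m) (axL p n) := by
  refine ⟨?_, ?_⟩
  · show 3 - (m : ℤ) < 3 - (n : ℤ)
    omega
  · show ((n : ℤ) * re4 p - (m : ℤ) * re4 p) ^ 2 + ((n : ℤ) * im4 p - (m : ℤ) * im4 p) ^ 2 = (3 - (n : ℤ) - (3 - (m : ℤ))) ^ 2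
    have hq := re4_sq_add_im4_sq p
    have e : ((n : ℤ) * re4 p - (m : ℤ) * re4 p) ^ 2 + ((n : ℤ) * im4 p - (m : ℤ) * im4 p) ^ 2 =
        ((n : ℤ) - m) ^ 2 * (re4 p * re4 p + im4 p * im4 p) := by ring
    rw [e, hq]
    ring

theorem hubC_apply (f : Fin 4) : hubC f = hub3 := by
  fin_cases f <;> rfl

theorem axL_zero (p : Fin 4) : axL p 0 = hub3 := by
  simp [axL, hub3]

theorem inst_ZEROV (τ : Ph) : inst τ ZEROV = hubC := by
  funext f
  rw [hubC_apply]
  fin_cases f <;> exact axL_zero _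

/-- the instantiated cell is weakly below the hub cell. -/
theorem weakLive_inst_hub (τ : Ph) (c : PV) : WeakLive (inst τ c) hubC := by
  intro f
  rw [hubC_apply]
  exact notDead_axL_hub _ _

theorem axisCell_inst (τ : Ph) (c : PV) : AxisCell (inst τ c) := fun f => isAxis_axL (τ f) (c f)

theorem axisCell_hubC : AxisCell hubC := by
  intro f; rw [hubC_apply]; show (0 : ℤ) * 0 = 0; rfl

/-- co-level sum of a cell. -/
def csum (z : Cell) : ℤ := (z 0).colevel + (z 1).colevel + (z 2).colevel + (z 3).colevel

theorem csum_inst (τ : Ph) (c : PV) : csum (inst τ c) = (c 0 + c 1 + c 2 + c 3 : ℕ) := by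
  simp only [csum, inst, colevel_axL]
  push_cast
  ring

theorem csum_hubC : csum hubC = 0 := by decide

/-! ## §7 Pattern-level tables (75 cells): bounds, parities, positivity, and the RULE-D CLOSURE CERTIFICATE -/

/-- bound test `c_f ≤ 3`. -/
def bndB (c : PV) : Bool := decide (c 0 ≤ 3) && decide (c 1 ≤ 3) && decide (c 2 ≤ 3) && decide (c 3 ≤ 3)

theorem bnd_of_B {c : PV} (h : bndB c = true) : ∀ f : Fin 4, c f ≤ 3 := by
  simp only [bndB, Bool.and_eq_true, decide_eq_true_eq] at h
  obtain ⟨⟨⟨h0, h1⟩, h2⟩, h3⟩ := h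
  intro f
  fin_cases f
  · exact h0
  · exact h1
  · exact h2
  · exact h3

theorem bndZN : allB ZN (fun e => bndB e.1) = true := by decide
theorem bndZP : allB ZP (fun e => bndB e.1) = true := by decide
theorem parZN : allB ZN (fun e => decide ((e.1 0 + e.1 1 + e.1 2 + e.1 3) % 2 = 0)) = true := by decide
theorem parZP : allB ZP (fun e => decide ((e.1 0 + e.1 1 + e.1 2 + e.1 3) % 2 = 1)) = true := by decide
theorem posZN : allB ZN (fun e => decide (0 < e.2)) = true := by decide
theorem posZP : allB ZP (fun e => decide (0 < e.2)) = true := by decide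
theorem posPH : allB PH (fun e => decide (0 < e.2)) = true := by decide

/-- the four factors. -/
def fins : List (Fin 4) := [0, 1, 2, 3]

theorem mem_fins (f : Fin 4) : f ∈ fins := by
  fin_cases f <;> simp [fins]

/-- the six blocks `g < j`. -/
def blocks : List (Fin 4 × Fin 4) := [(0, 1), (0, 2), (0, 3), (1, 2), (1, 3), (2, 3)]

theorem mem_blocks {g j : Fin 4} (h : g < j) : (g, j) ∈ blocks := by
  fin_cases g <;> fin_cases j <;> first | (simp [blocks]; done) | exact absurd h (by decide)

/-- pattern-level supplier test for the block `(g, j)`: `x` (the DEEPER cell) equals `y` off the block and is at least as deep on it. -/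
def supPatB (x y : PV) (g j : Fin 4) : Bool :=
  allB fins (fun f => decide (f = g) || decide (f = j) || decide (x f = y f)) && decide (y g ≤ x g) && decide (y j ≤ x j)

/-- along the rays of ONE box, the pattern-level test gives a genuine SUPPLIER PAIR. -/
theorem supplies_of_supPatB (τ : Ph) {x y : PV} {g j : Fin 4} (h : supPatB x y g j = true) : Supplies (inst τ x) (inst τ y) g j := by
  simp only [supPatB, Bool.and_eq_true, decide_eq_true_eq] at h
  obtain ⟨⟨hoff, hg⟩, hj⟩ := h
  rw [allB_iff] at hoff
  refine ⟨?_, ?_, ?_⟩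
  · intro f hfg hfj
    have hf := hoff f (mem_fins f)
    simp only [Bool.or_eq_true, decide_eq_true_eq] at hf
    rcases hf with (h1 | h2) | h3
    · exact (hfg h1).elim
    · exact (hfj h2).elim
    · show axL (τ f) (x f) = axL (τ f) (y f)
      rw [h3]
  · rcases Nat.eq_or_lt_of_le hg with h1 | h1
    · left; show axL (τ g) (x g) = axL (τ g) (y g); rw [h1]
    · right; exact nullStep_axL _ h1
  · rcases Nat.eq_or_lt_of_le hj with h1 | h1
    · left; show axL (τ j) (x j) = axL (τ j) (y j); rw [h1]
    · right; exact nullStep_axL _ h1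

/-- a block on which both pattern co-levels vanish does not detect. -/
theorem not_detects_inst (τ : Ph) {c : PV} {g j : Fin 4} (hg : c g = 0) (hj : c j = 0) : ¬ Detects (inst τ c) g j := by
  intro hd
  apply hd
  simp [inst, axL, hg, hj]

theorem not_detects_hubC (g j : Fin 4) : ¬ Detects hubC g j := by
  intro hd
  apply hd
  simp [hubC_apply, hub3]

/-- double-zero block test. -/
def zzB (c : PV) (b : Fin 4 × Fin 4) : Bool := decide (c b.1 = 0) && decide (c b.2 = 0)

theorem zz_of_B {c : PV} {b : Fin 4 × Fin 4} (h : zzB c b = true) : c b.1 = 0 ∧ c b.2 = 0 := by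
  simpa [zzB] using h

/-- **RULE-D CLOSURE CERTIFICATE, N-side**: every N-position (`𝟙` and `ZN`) has, on every block that is not double-zero, a supplier in `ZP`. -/
theorem certN : allB ((ONEV, 1) :: ZN) (fun e => allB blocks fun b => zzB e.1 b || anyB ZP fun x => supPatB x.1 e.1 b.1 b.2) = true := by
  decide

/-- **RULE-D CLOSURE CERTIFICATE, P-side**: every P-position has, on every block that is not double-zero, a supplied N-position among
the hub position, `𝟙` and `ZN`. -/
theorem certP : allB ZP (fun e => allB blocks fun b =>
    zzB e.1 b || supPatB e.1 ZEROV b.1 b.2 || supPatB e.1 ONEV b.1 b.2 || anyB ZN fun y => supPatB e.1 y.1 b.1 b.2) = true := by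
  decide

/-! ## §8 Membership in `R⋆` -/

theorem mem_RN {z : Cell × ℕ} (hz : z ∈ Rstar.N) :
    z = hubE ∨ ∃ e ∈ PH, z = (inst e.1 ONEV, e.2) ∨ ∃ y ∈ ZN, z = instE e.1 y := by
  change z ∈ hubE :: (PH.map (boxN ONEV ZN)).flatten at hz
  rcases List.mem_cons.1 hz with h | h
  · exact Or.inl h
  · right
    obtain ⟨l, hl, hzl⟩ := List.mem_flatten.1 h
    obtain ⟨e, he, rfl⟩ := List.mem_map.1 hl
    refine ⟨e, he, ?_⟩
    rcases List.mem_cons.1 hzl with h1 | h1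
    · exact Or.inl h1
    · obtain ⟨y, hy, hzy⟩ := List.mem_map.1 h1
      exact Or.inr ⟨y, hy, hzy.symm⟩

theorem mem_RP {z : Cell × ℕ} (hz : z ∈ Rstar.P) : ∃ e ∈ PH, ∃ x ∈ ZP, z = instE e.1 x := by
  change z ∈ (PH.map (boxP ZP)).flatten at hz
  obtain ⟨l, hl, hzl⟩ := List.mem_flatten.1 hz
  obtain ⟨e, he, rfl⟩ := List.mem_map.1 hl
  obtain ⟨x, hx, hzx⟩ := List.mem_map.1 hzl
  exact ⟨e, he, x, hx, hzx.symm⟩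

theorem hubE_mem : hubE ∈ Rstar.N := List.mem_cons_self

theorem one_mem_RN {e : Ph × ℕ} (he : e ∈ PH) : (inst e.1 ONEV, e.2) ∈ Rstar.N := by
  change _ ∈ hubE :: (PH.map (boxN ONEV ZN)).flatten
  exact List.mem_cons_of_mem _ (List.mem_flatten.2 ⟨boxN ONEV ZN e, List.mem_map.2 ⟨e, he, rfl⟩, List.mem_cons_self⟩)

theorem zn_mem_RN {e : Ph × ℕ} (he : e ∈ PH) {y : PV × ℕ} (hy : y ∈ ZN) : instE e.1 y ∈ Rstar.N := by
  change _ ∈ hubE :: (PH.map (boxN ONEV ZN)).flatten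
  exact List.mem_cons_of_mem _ (List.mem_flatten.2 ⟨boxN ONEV ZN e, List.mem_map.2 ⟨e, he, rfl⟩,
    List.mem_cons_of_mem _ (List.mem_map.2 ⟨y, hy, rfl⟩)⟩)

theorem zp_mem_RP {e : Ph × ℕ} (he : e ∈ PH) {x : PV × ℕ} (hx : x ∈ ZP) : instE e.1 x ∈ Rstar.P := by
  change _ ∈ (PH.map (boxP ZP)).flatten
  exact List.mem_flatten.2 ⟨boxP ZP e, List.mem_map.2 ⟨e, he, rfl⟩, List.mem_map.2 ⟨x, hx, rfl⟩⟩

/-- support cells of `R⋆`: N-cells are the hub cell or `inst τ c` with `c ∈ {𝟙} ∪ ZN`, P-cells are `inst τ c` with `c ∈ ZP`. -/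
theorem suppN_cases {c : Cell} (hc : c ∈ Rstar.suppN) : c = hubC ∨ ∃ e ∈ PH, ∃ y ∈ (ONEV, 1) :: ZN, c = inst e.1 y.1 := by
  obtain ⟨m, hm⟩ := exists_of_mem_suppN hc
  rcases mem_RN hm with h | ⟨e, he, h | ⟨y, hy, h⟩⟩
  · exact Or.inl (congrArg Prod.fst h)
  · exact Or.inr ⟨e, he, (ONEV, 1), List.mem_cons_self, congrArg Prod.fst h⟩
  · exact Or.inr ⟨e, he, y, List.mem_cons_of_mem _ hy, congrArg Prod.fst h⟩

theorem suppP_cases {c : Cell} (hc : c ∈ Rstar.suppP) : ∃ e ∈ PH, ∃ x ∈ ZP, c = inst e.1 x.1 := by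
  obtain ⟨m, hm⟩ := exists_of_mem_suppP hc
  obtain ⟨e, he, x, hx, h⟩ := mem_RP hm
  exact ⟨e, he, x, hx, congrArg Prod.fst h⟩

/-! ## §9 The certificate of `R⋆`: alphabet, axis room, `Disj`, RULE D, Hall -/

theorem onAlphabet_R : Rstar.OnAlphabet 3 := by
  intro c hc f
  rcases List.mem_append.1 hc with hN | hP
  · rcases suppN_cases hN with rfl | ⟨e, _, y, hy, rfl⟩
    · rw [hubC_apply]; exact ⟨by decide, by decide⟩
    · rcases List.mem_cons.1 hy with rfl | hy
      · exact onAlphabet_axL _ (by fin_cases f <;> decide)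
      · exact onAlphabet_axL _ (bnd_of_B ((allB_iff _ _).1 bndZN y hy) f)
  · obtain ⟨e, _, x, hx, rfl⟩ := suppP_cases hP
    exact onAlphabet_axL _ (bnd_of_B ((allB_iff _ _).1 bndZP x hx) f)

theorem axisRoom_R : AxisRoom Rstar := by
  intro c hc
  rcases List.mem_append.1 hc with hN | hP
  · rcases suppN_cases hN with rfl | ⟨e, _, y, _, rfl⟩
    · exact axisCell_hubC
    · exact axisCell_inst _ _
  · obtain ⟨e, _, x, _, rfl⟩ := suppP_cases hP
    exact axisCell_inst _ _

/-- N-cells have EVEN co-level sum, P-cells ODD: the supports are disjoint. -/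
theorem csum_suppN {c : Cell} (hc : c ∈ Rstar.suppN) : csum c % 2 = 0 := by
  rcases suppN_cases hc with rfl | ⟨e, _, y, hy, rfl⟩
  · rw [csum_hubC]; rfl
  · rw [csum_inst]
    rcases List.mem_cons.1 hy with rfl | hy
    · decide
    · have h := (allB_iff _ _).1 parZN y hy
      rw [decide_eq_true_eq] at h
      omega

theorem csum_suppP {c : Cell} (hc : c ∈ Rstar.suppP) : csum c % 2 = 1 := by
  obtain ⟨e, _, x, hx, rfl⟩ := suppP_cases hc
  rw [csum_inst]
  have h := (allB_iff _ _).1 parZP x hx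
  rw [decide_eq_true_eq] at h
  omega

theorem disj_R : Disj Rstar := by
  intro c hN hP
  have h1 := csum_suppN hN
  have h2 := csum_suppP hP
  omega

/-- **`R⋆` satisfies RULE D** (both clauses), from the pattern-level closure certificates transported along the rays of each box. -/
theorem ruleD_R : RuleD Rstar := by
  constructor
  · intro y hy g j hgj hdet
    rcases suppN_cases hy with rfl | ⟨e, he, c, hc, rfl⟩
    · exact (not_detects_hubC g j hdet).elim
    · have hrow := (allB_iff _ _).1 ((allB_iff _ _).1 certN c hc) (g, j) (mem_blocks hgj)
      simp only [Bool.or_eq_true] at hrow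
      rcases hrow with hzz | hsup
      · obtain ⟨h0, h1⟩ := zz_of_B hzz
        exact (not_detects_inst e.1 h0 h1 hdet).elim
      · obtain ⟨x, hx, hs⟩ := (anyB_iff _ _).1 hsup
        have hpos := (allB_iff _ _).1 posZP x hx
        rw [decide_eq_true_eq] at hpos
        exact ⟨inst e.1 x.1, mem_suppP_of (zp_mem_RP he hx) hpos, supplies_of_supPatB e.1 hs⟩
  · intro x hx g j hgj hdet
    obtain ⟨e, he, c, hc, rfl⟩ := suppP_cases hx
    have hrow := (allB_iff _ _).1 ((allB_iff _ _).1 certP c hc) (g, j) (mem_blocks hgj)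
    simp only [Bool.or_eq_true] at hrow
    rcases hrow with ((hzz | h0) | h1) | hzn
    · obtain ⟨h0, h1⟩ := zz_of_B hzz
      exact (not_detects_inst e.1 h0 h1 hdet).elim
    · refine ⟨hubC, mem_suppN_of hubE_mem (by decide), ?_⟩
      rw [← inst_ZEROV e.1]
      exact supplies_of_supPatB e.1 h0
    · have hpos := (allB_iff _ _).1 posPH e he
      rw [decide_eq_true_eq] at hpos
      exact ⟨inst e.1 ONEV, mem_suppN_of (one_mem_RN he) hpos, supplies_of_supPatB e.1 h1⟩
    · obtain ⟨y, hy, hs⟩ := (anyB_iff _ _).1 hzn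
      have hpos := (allB_iff _ _).1 posZN y hy
      rw [decide_eq_true_eq] at hpos
      exact ⟨inst e.1 y.1, mem_suppN_of (zn_mem_RN he hy) hpos, supplies_of_supPatB e.1 hs⟩

/-- **HEAVY-HUB SURPLUS LEMMA** (as in `AxisRoomInhabitant24` §1): one N-entry weakly above every P-entry with multiplicity ≥ P-mass + k
gives `HallPlusUp E k`. -/
theorem hallPlusUp_of_heavy_entry (E : Design) (k : ℕ) (e : Cell × ℕ) (he : e ∈ E.N)
    (habove : ∀ cm ∈ E.P, WeakLive cm.1 e.1) (hmass : (E.P.map Prod.snd).sum + k ≤ e.2) : HallPlusUp E k := by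
  intro S hS hpos T hT hcov
  obtain ⟨cm, hcm⟩ : ∃ cm, cm ∈ S := by
    cases S with
    | nil => simp at hpos
    | cons a l => exact ⟨a, List.mem_cons_self⟩
  have heT : e ∈ T := hcov e he ⟨cm, hcm, habove cm (hS.subset hcm)⟩
  have h1 : (S.map Prod.snd).sum ≤ (E.P.map Prod.snd).sum :=
    (hS.map Prod.snd).sum_le_sum (fun a _ => Nat.zero_le a)
  have h2 : e.2 ≤ (T.map Prod.snd).sum :=
    List.single_le_sum (fun a _ => Nat.zero_le a) e.2 (List.mem_map.2 ⟨e, heT, rfl⟩)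
  omega

theorem hub_above_R : ∀ cm ∈ Rstar.P, WeakLive cm.1 hubE.1 := by
  intro cm hcm
  obtain ⟨e, _, x, _, rfl⟩ := mem_RP hcm
  exact weakLive_inst_hub _ _

theorem hallPlusUp8_R : HallPlusUp Rstar 8 :=
  hallPlusUp_of_heavy_entry Rstar 8 hubE hubE_mem hub_above_R (by rw [massP_R]; decide)

theorem hallUp_R : HallUp Rstar := hallUp_of_hallPlusUp Rstar 8 hallPlusUp8_R

/-- the Σ-budget of record FAILS for `R⋆` (9908 copies; the budget allows at most 116). -/
theorem not_budget_R : ¬ BudgetClause sigmaH 0 Rstar := by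
  intro hb
  have h := copies_le_of_budget Rstar hallUp_R hb
  rw [copies_R] at h
  omega

/-- **THE CERTIFICATE OF `R⋆`** (height 3). -/
theorem cert_R : Rstar.OnAlphabet 3 ∧ AxisRoom Rstar ∧ Disj Rstar ∧ Rstar.A1 ∧ RuleD Rstar ∧ HallUp Rstar ∧ HallPlusUp Rstar 8 ∧
    Rstar.mu = ⟨32, 0⟩ ∧ Rstar.rank = 2708 ∧ Rstar.copies = 9908 ∧ ¬ BudgetClause sigmaH 0 Rstar :=
  ⟨onAlphabet_R, axisRoom_R, disj_R, a1_R, ruleD_R, hallUp_R, hallPlusUp8_R, mu_R, rank_R, copies_R, not_budget_R⟩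

/-! ## §10 Every height `h ≥ 3` -/

/-- the axis room is shift-invariant. -/
theorem axisRoom_shiftD (t : ℤ) (E : Design) (hR : AxisRoom E) : AxisRoom (shiftD t E) := by
  intro c hc
  rw [suppN_shift, suppP_shift, ← List.map_append] at hc
  obtain ⟨c₀, hc₀, rfl⟩ := List.mem_map.mp hc
  intro f
  have h0 := hR c₀ hc₀ f
  simp only [shiftCell, Letter.isAxis, shiftL_x, shiftL_y] at h0 ⊢
  exact h0

/-- `R⋆` transported to height `h`. -/
def RstarAt (h : ℤ) : Design := shiftD (h - 3) Rstar

theorem onAlphabet_RstarAt {h : ℤ} (hh : 3 ≤ h) : (RstarAt h).OnAlphabet h := by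
  have e : h = 3 + (h - 3) := by ring
  rw [RstarAt, e, add_sub_cancel_left]
  exact onAlphabet_shift_up Rstar 3 (h - 3) (by omega) onAlphabet_R

/-- **THE RULE-D AXIS INHABITANT AT EVERY HEIGHT `h ≥ 3`**: every binder of the door of record except the Σ-budget. -/
theorem cert_RstarAt {h : ℤ} (hh : 3 ≤ h) :
    (RstarAt h).OnAlphabet h ∧ AxisRoom (RstarAt h) ∧ Disj (RstarAt h) ∧ (RstarAt h).A1 ∧ RuleD (RstarAt h) ∧ HallUp (RstarAt h) ∧
    HallPlusUp (RstarAt h) 8 ∧ (RstarAt h).mu = ⟨32, 0⟩ ∧ (RstarAt h).rank = 2708 ∧ (RstarAt h).copies = 9908 ∧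
    ¬ BudgetClause sigmaH 0 (RstarAt h) := by
  refine ⟨onAlphabet_RstarAt hh, axisRoom_shiftD _ _ axisRoom_R, (disj_shiftD _ _).mpr disj_R, a1_shiftD _ _ a1_R,
    (ruleD_shiftD _ _).mpr ruleD_R, (hallUp_shiftD _ _).mpr hallUp_R, (hallPlusUp_shiftD _ _ 8).mpr hallPlusUp8_R, ?_, ?_, ?_, ?_⟩
  · rw [RstarAt, mu_shiftD, mu_R]
  · rw [RstarAt, rank_shift, rank_R]
  · rw [RstarAt, copies_shift, copies_R]
  · exact fun hb => not_budget_R ((budgetClause_shiftD sigmaH 0 sigmaH_shiftD _ _).mp hb)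

/-- existence form. -/
theorem exists_ruleD_axisRoom_inhabitant {h : ℤ} (hh : 3 ≤ h) :
    ∃ D : Design, D.OnAlphabet h ∧ AxisRoom D ∧ Disj D ∧ D.A1 ∧ RuleD D ∧ HallUp D ∧ HallPlusUp D 8 ∧ D.mu ≠ 0 ∧
      D.rank = 2708 ∧ D.copies = 9908 := by
  obtain ⟨hA, hR, hd, h1, hD, hu, hp, hμ, hr, hc, _⟩ := cert_RstarAt hh
  exact ⟨RstarAt h, hA, hR, hd, h1, hD, hu, hp, by rw [hμ]; decide, hr, hc⟩

/-! ## §11 What it settles: the door of record is carried by the Σ-BUDGET ALONE (in the axis room, hence everywhere budget-free) -/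

/-- **THE BUDGET-FREE DOOR OF RECORD FAILS at every height `h ≥ 3`**: `¬ SPlusB h ⊤`. -/
theorem not_sPlusB_top {h : ℤ} (hh : 3 ≤ h) : ¬ SPlusB h (fun _ => True) := by
  intro H
  obtain ⟨D, hA, _, hd, h1, hD, hu, hp, hμ, _, _⟩ := exists_ruleD_axisRoom_inhabitant hh
  exact H D hA hd h1 hD hu hp hμ trivial

/-- … even with the AXIS ROOM as the «budget»: `¬ SPlusB h AxisRoom` — every binder of `RuleDPlate.SPlus h sigmaH 0` other than the Σ-budget
is jointly satisfiable by an AXIS design. -/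
theorem not_sPlusB_axisRoom {h : ℤ} (hh : 3 ≤ h) : ¬ SPlusB h AxisRoom := by
  intro H
  obtain ⟨D, hA, hR, hd, h1, hD, hu, hp, hμ, _, _⟩ := exists_ruleD_axisRoom_inhabitant hh
  exact H D hA hd h1 hD hu hp hμ hR

/-- … and for ANY budget predicate met by the transported `R⋆`. -/
theorem not_sPlusB_of_budget {h : ℤ} (hh : 3 ≤ h) (Budget : Design → Prop) (hB : Budget (RstarAt h)) : ¬ SPlusB h Budget := by
  intro H
  obtain ⟨hA, hR, hd, h1, hD, hu, hp, hμ, _, _, _⟩ := cert_RstarAt hh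
  exact H (RstarAt h) hA hd h1 hD hu hp (by rw [hμ]; decide) hB

/-- **READING**: a budget predicate under which the door of record `SPlusB h Budget` holds must EXCLUDE `R⋆(h)`; for the budget of record this
is `not_budget_R` (9908 copies > 116).  So at every height `h ≥ 3` the statement of record `SPlus h sigmaH 0` is, in the axis room, a pure
SIZE statement: its only binder not met by a RULE-D, `Disj`, (A1)-clean, Hall axis design with `μ ≠ 0` is `Σ-H(D) + 28(rank − 4) ≤ 3136`. -/
theorem sPlusB_excludes_Rstar {h : ℤ} (hh : 3 ≤ h) (Budget : Design → Prop) (H : SPlusB h Budget) : ¬ Budget (RstarAt h) :=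
  fun hB => not_sPlusB_of_budget hh Budget hB H

end Summit.HodgeConjecture.HodgeConjecture.Cruxes.BlochSeedDiscOne.AxisRuleDInhabitant
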